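import Mathlib
import Summits.ABC.ABC.Theses.GvfSupportTransfer

/-!
# Birth skeleton (BC3) of split piece `PlaneMordell` (child of crux `LinearLawTransfer`, stmt-ABC-11084)

KNOWN piece (Faltings 1983): a prime `P ∈ ℚ[X,Y]` whose function field `ℚ(P) = Frac(ℚ[X,Y]/(P))` violates
`deg D + 1 − ℓ(D) ≤ 1` for some divisor over `ℚ` (genus ≥ 2) has only finitely many rational zeros. Three
registered stubs — (1) FALTINGS in function-field language: finitely many degree-one places of `ℚ(P)/ℚ`
(if `ℚ` is not algebraically closed in `ℚ(P)` there are none; otherwise they are the rational points of the smooth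
projective model, of genus ≥ 2); (2) nonsingular rational points of the affine curve INJECT into degree-one places
(the local ring of a nonsingular point of a plane curve is a discrete valuation ring with residue field `ℚ`);
(3) the SINGULAR rational points of an irreducible plane curve are finitely many (char 0: `P` is coprime to one of
its partial derivatives; resultants) — and the kernel-checked composition `PlaneMordell_of` (set bookkeeping:
`{P = 0}(ℚ) ⊆ Sing ∪ NonSing`, the latter finite as it injects into a finite set). Sorries ONLY inside `stub_*`.
-/

set_option linter.dupNamespace false

namespace Summit.ABC.ABC.Cruxes.LinearLawTransfer.Split

open scoped BigOperators
open Literature.NumberTheory.DiophantineGeometry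

/-- Split piece X₃ (support, known): Mordell–Faltings for plane curves over `ℚ` (verbatim the child statement). -/
def PlaneMordell : Prop :=
  ∀ (P : MvPolynomial (Fin 2) ℚ) (hP : Prime P), (haveI : (Ideal.span {P}).IsPrime := (Ideal.span_singleton_prime hP.ne_zero).mpr hP; ¬ ∀ D : Literature.NumberTheory.DiophantineGeometry.AlgFunctionField.Divisor ℚ (FractionRing (MvPolynomial (Fin 2) ℚ ⧸ Ideal.span {P})), D.degree + 1 - (Literature.NumberTheory.DiophantineGeometry.AlgFunctionField.ell D : ℤ) ≤ 1) → Set.Finite {p : ℚ × ℚ | MvPolynomial.aeval ![p.1, p.2] P = 0}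

/-- **stub 1 — FALTINGS (degree-one places).** For `P` prime with `¬ ∀ D, deg D + 1 − ℓ(D) ≤ 1` over `ℚ`, the set of
places of `ℚ(P)/ℚ` of degree one is finite. Paper proof: if the exact constant field `k'` of `ℚ(P)` is larger than
`ℚ`, every residue field contains `k'` and NO place has degree one; if `k' = ℚ`, `ℚ(P)` is the function field of a
smooth projective geometrically irreducible curve `C̃/ℚ` whose genus `g` satisfies `g = sup_D (deg D + 1 − ℓ(D)) ≥ 2`
(Riemann–Roch), degree-one places are the points of `C̃(ℚ)`, and `C̃(ℚ)` is finite by Faltings' theorem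
(Faltings 1983, Invent. Math. 73; B–G Thm 11.1.1). -/
theorem stub_faltingsPlaces :
    ∀ (P : MvPolynomial (Fin 2) ℚ) (hP : Prime P), (haveI : (Ideal.span {P}).IsPrime := (Ideal.span_singleton_prime hP.ne_zero).mpr hP; (¬ ∀ D : Literature.NumberTheory.DiophantineGeometry.AlgFunctionField.Divisor ℚ (FractionRing (MvPolynomial (Fin 2) ℚ ⧸ Ideal.span {P})), D.degree + 1 - (Literature.NumberTheory.DiophantineGeometry.AlgFunctionField.ell D : ℤ) ≤ 1) → Set.Finite {v : Literature.NumberTheory.DiophantineGeometry.AlgFunctionField.PlaceOver ℚ (FractionRing (MvPolynomial (Fin 2) ℚ ⧸ Ideal.span {P})) | v.degree = 1}) := by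
  sorry

/-- **stub 2 — NONSINGULAR POINTS INJECT INTO DEGREE-ONE PLACES.** For `P` prime, there is an injection from the
rational zeros `p = (a,b)` of `P` with `(∂P/∂X, ∂P/∂Y)(p) ≠ (0,0)` into the degree-one places of `ℚ(P)/ℚ`: the local
ring `ℚ[X,Y]_(X−a,Y−b)/(P)` is a regular local ring of dimension one, i.e. a DVR `O_p ⊂ ℚ(P)` containing `ℚ` with
residue field `ℚ`; `p ≠ p'` give different rings since `X − a, X − a' ∈ m_v` forces `a − a' ∈ m_v ∩ ℚ = 0`
(Fulton, *Algebraic Curves* §3.2 Thm 1; Stichtenoth I.1). -/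
theorem stub_pointsToPlaces :
    ∀ (P : MvPolynomial (Fin 2) ℚ) (hP : Prime P), (haveI : (Ideal.span {P}).IsPrime := (Ideal.span_singleton_prime hP.ne_zero).mpr hP; ∃ f : ↥{p : ℚ × ℚ | MvPolynomial.aeval ![p.1, p.2] P = 0 ∧ (MvPolynomial.aeval ![p.1, p.2] (MvPolynomial.pderiv 0 P) ≠ 0 ∨ MvPolynomial.aeval ![p.1, p.2] (MvPolynomial.pderiv 1 P) ≠ 0)} → ↥{v : Literature.NumberTheory.DiophantineGeometry.AlgFunctionField.PlaceOver ℚ (FractionRing (MvPolynomial (Fin 2) ℚ ⧸ Ideal.span {P})) | v.degree = 1}, Function.Injective f) := by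
  sorry

/-- **stub 3 — FINITELY MANY SINGULAR POINTS.** For `P` prime in `ℚ[X,Y]`, the rational zeros of `P` at which both
partial derivatives vanish are finitely many: in characteristic `0` an irreducible `P` of positive degree in (say)
`Y` does not divide `∂P/∂Y ≠ 0`, so `Res_Y(P, ∂P/∂Y) ≠ 0` bounds the `x`-coordinates, and symmetrically (or via
conjugate components when `P` is not geometrically irreducible) the `y`-coordinates (Fulton §3.1; B–G A.?). -/
theorem stub_singularFinite :
    ∀ (P : MvPolynomial (Fin 2) ℚ), Prime P → Set.Finite {p : ℚ × ℚ | MvPolynomial.aeval ![p.1, p.2] P = 0 ∧ MvPolynomial.aeval ![p.1, p.2] (MvPolynomial.pderiv 0 P) = 0 ∧ MvPolynomial.aeval ![p.1, p.2] (MvPolynomial.pderiv 1 P) = 0} := by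
  sorry

/-- **Composition (kernel-checked, no sorry): `stub_faltingsPlaces → stub_pointsToPlaces → stub_singularFinite →
PlaneMordell`.** `{P = 0}(ℚ) ⊆ Sing ∪ NonSing`; `Sing` is finite by stub 3, and `NonSing` injects (stub 2) into
the degree-one places, a finite set by stub 1 under the genus hypothesis. [folklore] -/
theorem PlaneMordell_of :
    (∀ (P : MvPolynomial (Fin 2) ℚ) (hP : Prime P), (haveI : (Ideal.span {P}).IsPrime := (Ideal.span_singleton_prime hP.ne_zero).mpr hP; (¬ ∀ D : Literature.NumberTheory.DiophantineGeometry.AlgFunctionField.Divisor ℚ (FractionRing (MvPolynomial (Fin 2) ℚ ⧸ Ideal.span {P})), D.degree + 1 - (Literature.NumberTheory.DiophantineGeometry.AlgFunctionField.ell D : ℤ) ≤ 1) → Set.Finite {v : Literature.NumberTheory.DiophantineGeometry.AlgFunctionField.PlaceOver ℚ (FractionRing (MvPolynomial (Fin 2) ℚ ⧸ Ideal.span {P})) | v.degree = 1})) →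
    (∀ (P : MvPolynomial (Fin 2) ℚ) (hP : Prime P), (haveI : (Ideal.span {P}).IsPrime := (Ideal.span_singleton_prime hP.ne_zero).mpr hP; ∃ f : ↥{p : ℚ × ℚ | MvPolynomial.aeval ![p.1, p.2] P = 0 ∧ (MvPolynomial.aeval ![p.1, p.2] (MvPolynomial.pderiv 0 P) ≠ 0 ∨ MvPolynomial.aeval ![p.1, p.2] (MvPolynomial.pderiv 1 P) ≠ 0)} → ↥{v : Literature.NumberTheory.DiophantineGeometry.AlgFunctionField.PlaceOver ℚ (FractionRing (MvPolynomial (Fin 2) ℚ ⧸ Ideal.span {P})) | v.degree = 1}, Function.Injective f)) →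
    (∀ (P : MvPolynomial (Fin 2) ℚ), Prime P → Set.Finite {p : ℚ × ℚ | MvPolynomial.aeval ![p.1, p.2] P = 0 ∧ MvPolynomial.aeval ![p.1, p.2] (MvPolynomial.pderiv 0 P) = 0 ∧ MvPolynomial.aeval ![p.1, p.2] (MvPolynomial.pderiv 1 P) = 0}) →
    PlaneMordell := by
  intro h1 h2 h3 P hP hg
  haveI hprime : (Ideal.span {P}).IsPrime := (Ideal.span_singleton_prime hP.ne_zero).mpr hP
  have hfin1 := h1 P hP hg
  obtain ⟨f, hf⟩ := h2 P hP
  have hsing := h3 P hP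
  have hns : Set.Finite {p : ℚ × ℚ | MvPolynomial.aeval ![p.1, p.2] P = 0 ∧ (MvPolynomial.aeval ![p.1, p.2] (MvPolynomial.pderiv 0 P) ≠ 0 ∨ MvPolynomial.aeval ![p.1, p.2] (MvPolynomial.pderiv 1 P) ≠ 0)} := by
    haveI := hfin1.to_subtype
    haveI := Finite.of_injective f hf
    exact Set.toFinite _
  refine (hsing.union hns).subset ?_
  intro p hp
  by_cases h : MvPolynomial.aeval ![p.1, p.2] (MvPolynomial.pderiv 0 P) = 0 ∧ MvPolynomial.aeval ![p.1, p.2] (MvPolynomial.pderiv 1 P) = 0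
  · exact Or.inl ⟨hp, h⟩
  · exact Or.inr ⟨hp, not_and_or.mp h⟩

end Summit.ABC.ABC.Cruxes.LinearLawTransfer.Split
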